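import Summits.AtomisticToContinuum.FouriersLaw.Theorems.LocalOhmBVLocalOhmOddPart
import Summits.AtomisticToContinuum.FouriersLaw.Theorems.LocalOhmBVLocalOhmShiftAverage
import Literature.MathematicalPhysics.KineticTheory.InfiniteChainCurrentMoments
import Literature.MathematicalPhysics.KineticTheory.InfiniteChainShiftInvariantUniqueness

/-!
# Current versus regularity for shift-invariant first-order functionals
(crux `LocalOhmBV.LocalOhm`, item stmt-AtomisticToContinuum-12009, line `registered`/birth; partial result
toward the rigidity stub `stub_oddSectorLiouvilleSym`, landed `--supports`)

For `P = pinnedChain ω₂ lam β γ`, a shift-invariant Gibbs state `μ` and a functional `Λ` which is shift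
invariant and linear on continuous polynomially bounded cylinder observables, the value on the bond current is
controlled by the regularity constant `A(M)` of `Λ` on boxes of `M + 1` sites:
`|Λ(j_0)| ≤ A(M) · (3 ∫ j_0² dμ / M)^{1/2}` for every `M ≥ 1`.
Proof: by linearity and shift invariance `Λ(j_0) = Λ(M⁻¹ Σ_{i<M} j_i)`, one cylinder observable on the box
`{0, …, M}`; its `L²(μ)`-norm is `≤ (3 ∫ j_0² / M)^{1/2}` because the static current covariances vanish beyond
nearest-neighbour bonds (`IsChainGibbsMeasure.integral_bondCurrentZ_mul_eq_zero`, partial momentum reversal)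
and `2|j_i j_k| ≤ j_i² + j_k²`. Consequence for the line: the rigidity stub would follow from regularity ALONE
if the extracted functional had `A(M) = o(√M)`; conversely every counterexample (e.g. the harmonic corner) has
`A(M) ≳ √M`, the CLT size of the window density of an extensive odd perturbation — so the content of the stub
is the invariance hypothesis, not the growth of `A`. No definitions.
-/

set_option autoImplicit false

noncomputable section

namespace Summit.AtomisticToContinuum.FouriersLaw.Theorems.LocalOhmBirth

open MeasureTheory Filter Topology
open scoped BigOperators
open Literature.MathematicalPhysics.KineticTheory
open Literature.MathematicalPhysics.KineticTheory.HeatConduction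

/-! ## The block average of the bond currents as one cylinder observable -/

/-- The `i`-th summand of the block current, read on the box `{0, …, M}`: the bond-current window function
applied to the pair of sites `(i, i+1)`. -/
theorem blockSummand_comp_boxRestrictAt (ω₂ lam β γ : ℝ) (M : ℕ) (i : Fin M) :
    (fun y : Fin (M + 1) → ℝ × ℝ =>
        -(((y i.castSucc).2 + (y i.succ).2) / 2 *
          (((y i.succ).1 - (y i.castSucc).1) + β * ((y i.succ).1 - (y i.castSucc).1) ^ 3))) ∘
        boxRestrictAt 0 M =
      fun σ => (pinnedChain ω₂ lam β γ).bondCurrentZ σ i := by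
  funext σ
  simp only [Function.comp_apply, boxRestrictAt, OscillatorChain.bondCurrentZ, pinnedChain_deriv_V,
    Fin.val_castSucc, Fin.val_succ, Nat.cast_add, Nat.cast_one, zero_add]

/-- The same summand is the bond-current cylinder observable on the two-site box `{i, i+1}`. -/
theorem blockSummand_eq_window (M : ℕ) (β : ℝ) (i : Fin M) :
    (fun y : Fin (M + 1) → ℝ × ℝ =>
        -(((y i.castSucc).2 + (y i.succ).2) / 2 *
          (((y i.succ).1 - (y i.castSucc).1) + β * ((y i.succ).1 - (y i.castSucc).1) ^ 3))) ∘
        boxRestrictAt 0 M =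
      (fun y : Fin (1 + 1) → ℝ × ℝ =>
        -(((y 0).2 + (y 1).2) / 2 * (((y 1).1 - (y 0).1) + β * ((y 1).1 - (y 0).1) ^ 3))) ∘
        boxRestrictAt (i : ℤ) 1 := by
  funext σ
  simp only [Function.comp_apply, boxRestrictAt, Fin.val_castSucc, Fin.val_succ, Nat.cast_add, Nat.cast_one,
    zero_add, Fin.val_zero, Nat.cast_zero, add_zero, Fin.val_one]

/-- Continuity of the summands. -/
theorem continuous_blockSummand (M : ℕ) (β : ℝ) (i : Fin M) :
    Continuous fun y : Fin (M + 1) → ℝ × ℝ =>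
      -(((y i.castSucc).2 + (y i.succ).2) / 2 *
        (((y i.succ).1 - (y i.castSucc).1) + β * ((y i.succ).1 - (y i.castSucc).1) ^ 3)) := by
  fun_prop

/-- Polynomial bound of the summands: `|w_i y| ≤ (2 + 8|β|)(1 + ‖y‖)⁴`. -/
theorem polyBound_blockSummand (M : ℕ) (β : ℝ) (i : Fin M) (y : Fin (M + 1) → ℝ × ℝ) :
    |(-(((y i.castSucc).2 + (y i.succ).2) / 2 *
        (((y i.succ).1 - (y i.castSucc).1) + β * ((y i.succ).1 - (y i.castSucc).1) ^ 3)))| ≤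
      (2 + 8 * |β|) * (1 + ‖y‖) ^ 4 := by
  -- reduce to the two-site window bound through the pair `(y i, y (i+1))`
  have h := polyBound_bondCurrentWindow β ![y i.castSucc, y i.succ]
  have hn : ‖(![y i.castSucc, y i.succ] : Fin (1 + 1) → ℝ × ℝ)‖ ≤ ‖y‖ := by
    refine (pi_norm_le_iff_of_nonneg (norm_nonneg y)).2 fun j => ?_
    fin_cases j
    · exact norm_le_pi_norm y i.castSucc
    · exact norm_le_pi_norm y i.succ
  have hβ : 0 ≤ 2 + 8 * |β| := by positivity
  calc |(-(((y i.castSucc).2 + (y i.succ).2) / 2 *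
          (((y i.succ).1 - (y i.castSucc).1) + β * ((y i.succ).1 - (y i.castSucc).1) ^ 3)))|
        ≤ (2 + 8 * |β|) * (1 + ‖(![y i.castSucc, y i.succ] : Fin (1 + 1) → ℝ × ℝ)‖) ^ 4 := by
          simpa using h
    _ ≤ (2 + 8 * |β|) * (1 + ‖y‖) ^ 4 := by
          gcongr

/-! ## Linearity over finite sums and shift invariance along the chain -/

/-- A functional linear on continuous polynomially bounded cylinder pairs is additive over finite sums of
uniformly polynomially bounded continuous window functions. -/
theorem apply_sum_comp_boxRestrictAt (Λ : (ChainConfig → ℝ) → ℝ)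
    (hlin : ∀ (a : ℤ) (n : ℕ) (c₁ c₂ : ℝ) (g₁ g₂ : (Fin (n + 1) → ℝ × ℝ) → ℝ), Continuous g₁ →
      Continuous g₂ →
      (∃ (C₀ : ℝ) (m : ℕ), ∀ y, |g₁ y| ≤ C₀ * (1 + ‖y‖) ^ m ∧ |g₂ y| ≤ C₀ * (1 + ‖y‖) ^ m) →
      Λ ((fun y => c₁ * g₁ y + c₂ * g₂ y) ∘ boxRestrictAt a n) =
        c₁ * Λ (g₁ ∘ boxRestrictAt a n) + c₂ * Λ (g₂ ∘ boxRestrictAt a n))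
    (a : ℤ) (n : ℕ) {ι : Type*} (s : Finset ι) (w : ι → (Fin (n + 1) → ℝ × ℝ) → ℝ)
    (hw : ∀ i, Continuous (w i)) {C₀ : ℝ} {m : ℕ} (hC₀ : 0 ≤ C₀) (hb : ∀ i y, |w i y| ≤ C₀ * (1 + ‖y‖) ^ m) :
    Λ ((fun y => ∑ i ∈ s, w i y) ∘ boxRestrictAt a n) = ∑ i ∈ s, Λ (w i ∘ boxRestrictAt a n) := by
  classical
  induction s using Finset.induction_on with
  | empty =>
    simp only [Finset.sum_empty]
    -- `Λ` of the zero window: linearity with both coefficients `0`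
    have h := hlin a n 0 0 (fun _ => (0 : ℝ)) (fun _ => (0 : ℝ)) continuous_const continuous_const
      ⟨0, 0, fun y => by simp⟩
    simpa using h
  | insert j s hj ih =>
    rw [Finset.sum_insert hj]
    have hfun2 : (fun y => ∑ i ∈ insert j s, w i y) = fun y => w j y + ∑ i ∈ s, w i y :=
      funext fun y => Finset.sum_insert hj
    have hsum_cont : Continuous fun y => ∑ i ∈ s, w i y := continuous_finsetSum s fun i _ => hw i
    have hsum_bd : ∀ y, |∑ i ∈ s, w i y| ≤ (s.card + 1) * C₀ * (1 + ‖y‖) ^ m := by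
      intro y
      calc |∑ i ∈ s, w i y| ≤ ∑ i ∈ s, |w i y| := Finset.abs_sum_le_sum_abs _ _
        _ ≤ ∑ _i ∈ s, C₀ * (1 + ‖y‖) ^ m := Finset.sum_le_sum fun i _ => hb i y
        _ = s.card * (C₀ * (1 + ‖y‖) ^ m) := by rw [Finset.sum_const, nsmul_eq_mul]
        _ ≤ (s.card + 1) * C₀ * (1 + ‖y‖) ^ m := by
            have : 0 ≤ C₀ * (1 + ‖y‖) ^ m := by positivity
            nlinarith
    have hj_bd : ∀ y, |w j y| ≤ (s.card + 1) * C₀ * (1 + ‖y‖) ^ m := by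
      intro y
      refine (hb j y).trans ?_
      have : 0 ≤ C₀ * (1 + ‖y‖) ^ m := by positivity
      have hc : (1 : ℝ) ≤ s.card + 1 := by
        have : (0 : ℝ) ≤ s.card := Nat.cast_nonneg _
        linarith
      nlinarith
    have h := hlin a n 1 1 (w j) (fun y => ∑ i ∈ s, w i y) (hw j) hsum_cont
      ⟨(s.card + 1) * C₀, m, fun y => ⟨hj_bd y, hsum_bd y⟩⟩
    simp only [one_mul] at h
    rw [hfun2, h, ih]

/-- Shift invariance on two-site cylinder observables propagates along the chain: all translates to the
right have the same value. -/
theorem apply_window_eq_of_shiftInvariant (Λ : (ChainConfig → ℝ) → ℝ) {n : ℕ}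
    (g : (Fin (n + 1) → ℝ × ℝ) → ℝ)
    (hshift : ∀ a : ℤ, Λ ((g ∘ boxRestrictAt a n) ∘ shift) = Λ (g ∘ boxRestrictAt a n)) (k : ℕ) :
    Λ (g ∘ boxRestrictAt (k : ℤ) n) = Λ (g ∘ boxRestrictAt 0 n) := by
  induction k with
  | zero => simp
  | succ k ih =>
    rw [← ih, ← hshift (k : ℤ)]
    have h := comp_boxRestrictAt_comp_chainShift (k : ℤ) 1 n g
    rw [chainShift_one] at h
    rw [h]
    push_cast
    rfl

/-! ## The `L²` size of the block-averaged current -/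

/-- At most three bonds are within distance one of a given bond. -/
theorem card_filter_near_le_three (M : ℕ) (i : Fin M) :
    (Finset.univ.filter fun k : Fin M => ((i : ℤ) - k).natAbs ≤ 1).card ≤ 3 := by
  classical
  calc (Finset.univ.filter fun k : Fin M => ((i : ℤ) - k).natAbs ≤ 1).card
      ≤ ({(i : ℕ) - 1, (i : ℕ), (i : ℕ) + 1} : Finset ℕ).card := by
        refine Finset.card_le_card_of_injOn (fun k => (k : ℕ)) (fun k hk => ?_) ?_
        · have hk' : ((i : ℤ) - k).natAbs ≤ 1 := (Finset.mem_filter.1 hk).2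
          simp only [Finset.coe_insert, Finset.coe_singleton, Set.mem_insert_iff, Set.mem_singleton_iff]
          omega
        · intro k₁ _ k₂ _ h
          exact Fin.ext h
    _ ≤ 3 := Finset.card_le_three

/-- **The block average of `M` consecutive bond currents has `L²(μ)`-norm `≤ (3 ∫ j_0² dμ / M)^{1/2}`**
for every shift-invariant Gibbs state of the pinned anharmonic chain: the static current covariances vanish
beyond nearest-neighbour bonds (`IsChainGibbsMeasure.integral_bondCurrentZ_mul_eq_zero`) and
`2|j_i j_k| ≤ j_i² + j_k²`, `∫ j_i² = ∫ j_0²` (shift invariance). -/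
theorem integral_sq_blockCurrent_le {ω₂ lam β : ℝ} (γ : ℝ) (hω : 0 < ω₂) (hl : 0 < lam) (hβ : 0 < β)
    {T : ℝ} (hT : 0 < T) {μ : Measure ChainConfig} (hG : (pinnedChain ω₂ lam β γ).IsChainGibbsMeasure T μ)
    (hS : IsShiftInvariant μ) (M : ℕ) (hM : 1 ≤ M) :
    ∫ σ, ((M : ℝ)⁻¹ * ∑ i : Fin M, (pinnedChain ω₂ lam β γ).bondCurrentZ σ i) ^ 2 ∂μ ≤
      3 * (∫ σ, ((pinnedChain ω₂ lam β γ).bondCurrentZ σ 0) ^ 2 ∂μ) / M := by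
  set P := pinnedChain ω₂ lam β γ with hP
  -- square integrability of the currents (superstability of the shift-invariant Gibbs state)
  have hss : P.HasSuperstabilityEstimate μ :=
    OscillatorChain.hasSuperstabilityEstimate_of_isShiftInvariant_pinnedChain γ hω hl.le hβ.le hT hG hS
  have hV : OscillatorChain.IsEvenPolyOfDegree P.V 2 := OscillatorChain.pinnedChain_isEvenPolyOfDegree_V ω₂ lam γ hβ
  have hU0 : ∀ r, 0 ≤ P.U r := OscillatorChain.pinnedChain_U_nonneg β γ hω.le hl.le
  have hUm : Measurable P.U := by
    have : Continuous fun q : ℝ => ω₂ * q ^ 2 / 2 + lam * q ^ 4 / 4 := by fun_prop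
    exact this.measurable
  have hL2 : ∀ x : ℤ, MemLp (fun σ => P.bondCurrentZ σ x) 2 μ := fun x =>
    hss.memLp_bondCurrentZ (s₂ := 2) (by norm_num) hU0 hUm hV x (by simp)
  have hprod : ∀ x y : ℤ, Integrable (fun σ => P.bondCurrentZ σ x * P.bondCurrentZ σ y) μ := fun x y =>
    (hL2 x).integrable_mul (hL2 y)
  have hsq : ∀ x : ℤ, Integrable (fun σ => (P.bondCurrentZ σ x) ^ 2) μ := fun x => (hL2 x).integrable_sq
  -- shift invariance of the second moments
  set c := ∫ σ, (P.bondCurrentZ σ 0) ^ 2 ∂μ with hc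
  have hc0 : 0 ≤ c := integral_nonneg fun σ => sq_nonneg _
  have hsq_eq : ∀ x : ℤ, ∫ σ, (P.bondCurrentZ σ x) ^ 2 ∂μ = c := by
    intro x
    have h := integral_comp_chainShift_of_isShiftInvariant hS x (fun σ => (P.bondCurrentZ σ 0) ^ 2)
    simp only [OscillatorChain.bondCurrentZ_chainShift, zero_add] at h
    exact h
  -- every current covariance is `≤ c`, and `= 0` beyond nearest neighbours
  have hpair : ∀ x y : ℤ, ∫ σ, P.bondCurrentZ σ x * P.bondCurrentZ σ y ∂μ ≤
      if ((x - y).natAbs ≤ 1) then c else 0 := by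
    intro x y
    split_ifs with hxy
    · -- `2 j_x j_y ≤ j_x² + j_y²`
      have h2 : ∫ σ, 2 * (P.bondCurrentZ σ x * P.bondCurrentZ σ y) ∂μ ≤
          ∫ σ, ((P.bondCurrentZ σ x) ^ 2 + (P.bondCurrentZ σ y) ^ 2) ∂μ :=
        integral_mono ((hprod x y).const_mul 2) ((hsq x).add (hsq y)) fun σ => by
          have := two_mul_le_add_sq (P.bondCurrentZ σ x) (P.bondCurrentZ σ y)
          linarith
      rw [integral_const_mul, integral_add (hsq x) (hsq y), hsq_eq x, hsq_eq y] at h2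
      linarith
    · have h1 : 2 ≤ (x - y).natAbs := by omega
      have h2 : 2 ≤ |y - x| := by
        rw [abs_sub_comm, Int.abs_eq_natAbs]
        exact_mod_cast h1
      exact (hG.integral_bondCurrentZ_mul_eq_zero (x := y) (y := x) h2).le
  -- expand the square of the sum and integrate termwise
  have hexp : ∀ σ, ((M : ℝ)⁻¹ * ∑ i : Fin M, P.bondCurrentZ σ i) ^ 2 =
      ((M : ℝ)⁻¹) ^ 2 * ∑ i : Fin M, ∑ k : Fin M, P.bondCurrentZ σ i * P.bondCurrentZ σ k := by
    intro σ
    rw [mul_pow, sq (∑ i : Fin M, P.bondCurrentZ σ i), Finset.sum_mul_sum]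
  simp_rw [hexp]
  rw [integral_const_mul, integral_finsetSum _ fun i _ => integrable_finsetSum _ fun k _ => hprod _ _]
  have hinner : ∀ i : Fin M, ∫ σ, ∑ k : Fin M, P.bondCurrentZ σ i * P.bondCurrentZ σ k ∂μ ≤ 3 * c := by
    intro i
    rw [integral_finsetSum _ fun k _ => hprod _ _]
    calc ∑ k : Fin M, ∫ σ, P.bondCurrentZ σ i * P.bondCurrentZ σ k ∂μ
        ≤ ∑ k : Fin M, (if (((i : ℤ) - k).natAbs ≤ 1) then c else 0) :=
          Finset.sum_le_sum fun k _ => hpair _ _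
      _ = ∑ k ∈ Finset.univ.filter (fun k : Fin M => ((i : ℤ) - k).natAbs ≤ 1), c := by
          rw [Finset.sum_filter]
      _ = (Finset.univ.filter fun k : Fin M => ((i : ℤ) - k).natAbs ≤ 1).card * c := by
          rw [Finset.sum_const, nsmul_eq_mul]
      _ ≤ 3 * c := by
          have h3 := card_filter_near_le_three M i
          exact mul_le_mul_of_nonneg_right (by exact_mod_cast h3) hc0
  have hsum : ∑ i : Fin M, ∫ σ, ∑ k : Fin M, P.bondCurrentZ σ i * P.bondCurrentZ σ k ∂μ ≤ M * (3 * c) := by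
    calc ∑ i : Fin M, ∫ σ, ∑ k : Fin M, P.bondCurrentZ σ i * P.bondCurrentZ σ k ∂μ
        ≤ ∑ _i : Fin M, 3 * c := Finset.sum_le_sum fun i _ => hinner i
      _ = M * (3 * c) := by rw [Finset.sum_const, Finset.card_univ, Fintype.card_fin, nsmul_eq_mul]
  have hMpos : (0 : ℝ) < M := by exact_mod_cast hM
  calc ((M : ℝ)⁻¹) ^ 2 * ∑ i : Fin M, ∫ σ, ∑ k : Fin M, P.bondCurrentZ σ i * P.bondCurrentZ σ k ∂μ
      ≤ ((M : ℝ)⁻¹) ^ 2 * (M * (3 * c)) := mul_le_mul_of_nonneg_left hsum (by positivity)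
    _ = 3 * c / M := by field_simp

/-! ## Current versus regularity -/

/-- **`|Λ(j_0)| ≤ A(M) (3 ∫ j_0² dμ / M)^{1/2}`.** For a shift-invariant Gibbs state `μ` of
`pinnedChain ω₂ lam β γ` (all parameters `> 0`, `T > 0`) and a functional `Λ` that is shift invariant and
linear on continuous polynomially bounded cylinder observables, any admissible regularity constant `A ≥ 0`
on boxes of `M + 1` sites (`M ≥ 1`) controls the value on the bond current by `A · (3 ∫ j_0² / M)^{1/2}`.
In particular a shift-invariant, linear, regular functional with `Λ(j_0) ≠ 0` (a counterexample to the
rigidity stub `stub_oddSectorLiouvilleSym`) must have regularity constants `A(M) ≥ c √M`, and the stub holds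
for every functional class with `liminf_M A(M)/√M = 0` — without using invariance. -/
theorem abs_current_le_of_shiftInvariant_regular : ∀ {ω₂ lam β : ℝ} (γ : ℝ), 0 < ω₂ → 0 < lam →
    0 < β → ∀ {T : ℝ}, 0 < T → ∀ {μ : Measure ChainConfig},
    (pinnedChain ω₂ lam β γ).IsChainGibbsMeasure T μ → IsShiftInvariant μ →
    ∀ (Λ : (ChainConfig → ℝ) → ℝ),
    (∀ (a : ℤ) (n : ℕ) (g : (Fin (n + 1) → ℝ × ℝ) → ℝ), Continuous g →
      (∃ (C₀ : ℝ) (m : ℕ), ∀ y, |g y| ≤ C₀ * (1 + ‖y‖) ^ m) →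
      Λ ((g ∘ boxRestrictAt a n) ∘ shift) = Λ (g ∘ boxRestrictAt a n)) →
    (∀ (a : ℤ) (n : ℕ) (c₁ c₂ : ℝ) (g₁ g₂ : (Fin (n + 1) → ℝ × ℝ) → ℝ), Continuous g₁ →
      Continuous g₂ →
      (∃ (C₀ : ℝ) (m : ℕ), ∀ y, |g₁ y| ≤ C₀ * (1 + ‖y‖) ^ m ∧ |g₂ y| ≤ C₀ * (1 + ‖y‖) ^ m) →
      Λ ((fun y => c₁ * g₁ y + c₂ * g₂ y) ∘ boxRestrictAt a n) =
        c₁ * Λ (g₁ ∘ boxRestrictAt a n) + c₂ * Λ (g₂ ∘ boxRestrictAt a n)) →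
    ∀ {M : ℕ}, 1 ≤ M → ∀ {A : ℝ}, 0 ≤ A →
    (∀ (a : ℤ) (g : (Fin (M + 1) → ℝ × ℝ) → ℝ), Continuous g →
      (∃ (C₀ : ℝ) (m : ℕ), ∀ y, |g y| ≤ C₀ * (1 + ‖y‖) ^ m) →
      |Λ (g ∘ boxRestrictAt a M)| ≤ A * Real.sqrt (∫ σ, (g (boxRestrictAt a M σ)) ^ 2 ∂μ)) →
    |Λ (fun σ => (pinnedChain ω₂ lam β γ).bondCurrentZ σ 0)| ≤
      A * Real.sqrt (3 * (∫ σ, ((pinnedChain ω₂ lam β γ).bondCurrentZ σ 0) ^ 2 ∂μ) / M) := by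
  intro ω₂ lam β γ hω hl hβ T hT μ hG hS Λ hshift hlin M hM A hA0 hA
  set P := pinnedChain ω₂ lam β γ with hP
  -- the summands and the block average as window functions on the box `{0, …, M}`
  set w : Fin M → (Fin (M + 1) → ℝ × ℝ) → ℝ := fun i y =>
    -(((y i.castSucc).2 + (y i.succ).2) / 2 *
      (((y i.succ).1 - (y i.castSucc).1) + β * ((y i.succ).1 - (y i.castSucc).1) ^ 3)) with hw
  have hwc : ∀ i, Continuous (w i) := fun i => continuous_blockSummand M β i
  have hwb : ∀ i y, |w i y| ≤ (2 + 8 * |β|) * (1 + ‖y‖) ^ 4 := fun i y => polyBound_blockSummand M β i y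
  have hC0 : 0 ≤ 2 + 8 * |β| := by positivity
  have hsumc : Continuous fun y => ∑ i : Fin M, w i y := continuous_finsetSum _ fun i _ => hwc i
  have hsumb : ∀ y, |∑ i : Fin M, w i y| ≤ M * (2 + 8 * |β|) * (1 + ‖y‖) ^ 4 := by
    intro y
    calc |∑ i : Fin M, w i y| ≤ ∑ i : Fin M, |w i y| := Finset.abs_sum_le_sum_abs _ _
      _ ≤ ∑ _i : Fin M, (2 + 8 * |β|) * (1 + ‖y‖) ^ 4 := Finset.sum_le_sum fun i _ => hwb i y
      _ = M * (2 + 8 * |β|) * (1 + ‖y‖) ^ 4 := by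
          rw [Finset.sum_const, Finset.card_univ, Fintype.card_fin, nsmul_eq_mul]; ring
  -- Step A: `Λ(M⁻¹ Σ w_i ∘ box) = Λ(j_0)` by linearity and shift invariance
  have hΛsum : Λ ((fun y => ∑ i : Fin M, w i y) ∘ boxRestrictAt 0 M) = M * Λ (fun σ => P.bondCurrentZ σ 0) := by
    rw [apply_sum_comp_boxRestrictAt Λ hlin 0 M Finset.univ w hwc hC0 hwb]
    have hterm : ∀ i : Fin M, Λ (w i ∘ boxRestrictAt 0 M) = Λ (fun σ => P.bondCurrentZ σ 0) := by
      intro i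
      have h1 : w i ∘ boxRestrictAt 0 M =
          (fun y : Fin (1 + 1) → ℝ × ℝ =>
            -(((y 0).2 + (y 1).2) / 2 * (((y 1).1 - (y 0).1) + β * ((y 1).1 - (y 0).1) ^ 3))) ∘
            boxRestrictAt (i : ℤ) 1 := blockSummand_eq_window M β i
      rw [h1]
      have h2 := apply_window_eq_of_shiftInvariant Λ
        (fun y : Fin (1 + 1) → ℝ × ℝ =>
          -(((y 0).2 + (y 1).2) / 2 * (((y 1).1 - (y 0).1) + β * ((y 1).1 - (y 0).1) ^ 3)))
        (fun a => hshift a 1 _ (continuous_bondCurrentWindow β)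
          ⟨2 + 8 * |β|, 4, polyBound_bondCurrentWindow β⟩) i
      have h3 : ((i : ℕ) : ℤ) = (i : ℤ) := rfl
      rw [h2, ← bondCurrentZ_pinnedChain_eq_comp_boxRestrictAt ω₂ lam β γ 0]
    simp only [hterm, Finset.sum_const, Finset.card_univ, Fintype.card_fin, nsmul_eq_mul]
  have hΛavg : Λ ((fun y => (M : ℝ)⁻¹ * ∑ i : Fin M, w i y) ∘ boxRestrictAt 0 M) =
      Λ (fun σ => P.bondCurrentZ σ 0) := by
    have h := hlin 0 M (M : ℝ)⁻¹ 0 (fun y => ∑ i : Fin M, w i y) (fun y => ∑ i : Fin M, w i y) hsumc hsumc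
      ⟨M * (2 + 8 * |β|), 4, fun y => ⟨hsumb y, hsumb y⟩⟩
    have hfun : (fun y => (M : ℝ)⁻¹ * ∑ i : Fin M, w i y + 0 * ∑ i : Fin M, w i y) =
        fun y => (M : ℝ)⁻¹ * ∑ i : Fin M, w i y := by
      funext y; ring
    rw [hfun] at h
    rw [h, hΛsum]
    have hMne : (M : ℝ) ≠ 0 := by exact_mod_cast (Nat.one_le_iff_ne_zero.1 hM)
    field_simp
    ring
  -- Step B: the regularity bound on the box `{0, …, M}` and the `L²` size of the block average
  have hbound := hA 0 (fun y => (M : ℝ)⁻¹ * ∑ i : Fin M, w i y) (continuous_const.mul hsumc)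
    ⟨(M : ℝ)⁻¹ * (M * (2 + 8 * |β|)), 4, fun y => by
      rw [abs_mul, abs_of_nonneg (by positivity : (0 : ℝ) ≤ (M : ℝ)⁻¹), mul_assoc]
      exact mul_le_mul_of_nonneg_left (hsumb y) (by positivity)⟩
  rw [hΛavg] at hbound
  have hblock : ∀ σ, (fun y => (M : ℝ)⁻¹ * ∑ i : Fin M, w i y) (boxRestrictAt 0 M σ) =
      (M : ℝ)⁻¹ * ∑ i : Fin M, P.bondCurrentZ σ i := by
    intro σ
    simp only []
    congr 1
    refine Finset.sum_congr rfl fun i _ => ?_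
    exact congrFun (blockSummand_comp_boxRestrictAt ω₂ lam β γ M i) σ
  simp only [hblock] at hbound
  refine hbound.trans (mul_le_mul_of_nonneg_left (Real.sqrt_le_sqrt ?_) hA0)
  exact integral_sq_blockCurrent_le γ hω hl hβ hT hG hS M hM

/-- **Sub-`√M` regularity forces zero current.** If a shift-invariant linear functional admits, for every
`ε > 0`, a box size `M ≥ 1` and a regularity constant `A ≤ ε √M` on boxes of `M + 1` sites, then `Λ(j_0) = 0`
— the rigidity stub `stub_oddSectorLiouvilleSym` restricted to such functionals holds WITHOUT the invariance
hypothesis (and without oddness). The extracted functional of the line is not known to be of this kind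
(`A(M) ≍ √M` is the generic size), which is why the stub proper needs invariance. -/
theorem current_eq_zero_of_subsqrt_regular {ω₂ lam β : ℝ} (γ : ℝ) (hω : 0 < ω₂) (hl : 0 < lam)
    (hβ : 0 < β) {T : ℝ} (hT : 0 < T) {μ : Measure ChainConfig}
    (hG : (pinnedChain ω₂ lam β γ).IsChainGibbsMeasure T μ) (hS : IsShiftInvariant μ)
    (Λ : (ChainConfig → ℝ) → ℝ)
    (hshift : ∀ (a : ℤ) (n : ℕ) (g : (Fin (n + 1) → ℝ × ℝ) → ℝ), Continuous g →
      (∃ (C₀ : ℝ) (m : ℕ), ∀ y, |g y| ≤ C₀ * (1 + ‖y‖) ^ m) →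
      Λ ((g ∘ boxRestrictAt a n) ∘ shift) = Λ (g ∘ boxRestrictAt a n))
    (hlin : ∀ (a : ℤ) (n : ℕ) (c₁ c₂ : ℝ) (g₁ g₂ : (Fin (n + 1) → ℝ × ℝ) → ℝ), Continuous g₁ →
      Continuous g₂ →
      (∃ (C₀ : ℝ) (m : ℕ), ∀ y, |g₁ y| ≤ C₀ * (1 + ‖y‖) ^ m ∧ |g₂ y| ≤ C₀ * (1 + ‖y‖) ^ m) →
      Λ ((fun y => c₁ * g₁ y + c₂ * g₂ y) ∘ boxRestrictAt a n) =
        c₁ * Λ (g₁ ∘ boxRestrictAt a n) + c₂ * Λ (g₂ ∘ boxRestrictAt a n))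
    (hsub : ∀ ε : ℝ, 0 < ε → ∃ (M : ℕ) (A : ℝ), 1 ≤ M ∧ 0 ≤ A ∧ A ≤ ε * Real.sqrt M ∧
      ∀ (a : ℤ) (g : (Fin (M + 1) → ℝ × ℝ) → ℝ), Continuous g →
        (∃ (C₀ : ℝ) (m : ℕ), ∀ y, |g y| ≤ C₀ * (1 + ‖y‖) ^ m) →
        |Λ (g ∘ boxRestrictAt a M)| ≤ A * Real.sqrt (∫ σ, (g (boxRestrictAt a M σ)) ^ 2 ∂μ)) :
    Λ (fun σ => (pinnedChain ω₂ lam β γ).bondCurrentZ σ 0) = 0 := by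
  set c := ∫ σ, ((pinnedChain ω₂ lam β γ).bondCurrentZ σ 0) ^ 2 ∂μ with hc
  have hc0 : 0 ≤ c := integral_nonneg fun σ => sq_nonneg _
  -- `|Λ(j_0)| ≤ ε √(3c)` for every `ε > 0`
  have hle : ∀ ε : ℝ, 0 < ε → |Λ (fun σ => (pinnedChain ω₂ lam β γ).bondCurrentZ σ 0)| ≤ ε * Real.sqrt (3 * c) := by
    intro ε hε
    obtain ⟨M, A, hM, hA0, hAε, hA⟩ := hsub ε hε
    have h := abs_current_le_of_shiftInvariant_regular γ hω hl hβ hT hG hS Λ hshift hlin hM hA0 hA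
    have hMpos : (0 : ℝ) < M := by exact_mod_cast hM
    calc |Λ (fun σ => (pinnedChain ω₂ lam β γ).bondCurrentZ σ 0)|
        ≤ A * Real.sqrt (3 * c / M) := h
      _ ≤ ε * Real.sqrt M * Real.sqrt (3 * c / M) :=
          mul_le_mul_of_nonneg_right hAε (Real.sqrt_nonneg _)
      _ = ε * Real.sqrt (3 * c) := by
          rw [mul_assoc, ← Real.sqrt_mul (Nat.cast_nonneg M)]
          congr 2
          field_simp
  -- hence `Λ(j_0) = 0`
  by_contra hne
  have hpos : 0 < |Λ (fun σ => (pinnedChain ω₂ lam β γ).bondCurrentZ σ 0)| := abs_pos.2 hne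
  by_cases hc3 : Real.sqrt (3 * c) = 0
  · have := hle 1 one_pos
    rw [hc3, mul_zero] at this
    linarith
  · have hs : 0 < Real.sqrt (3 * c) := lt_of_le_of_ne (Real.sqrt_nonneg _) (Ne.symm hc3)
    have := hle (|Λ (fun σ => (pinnedChain ω₂ lam β γ).bondCurrentZ σ 0)| / (2 * Real.sqrt (3 * c)))
      (by positivity)
    have heq : |Λ (fun σ => (pinnedChain ω₂ lam β γ).bondCurrentZ σ 0)| / (2 * Real.sqrt (3 * c)) *
        Real.sqrt (3 * c) = |Λ (fun σ => (pinnedChain ω₂ lam β γ).bondCurrentZ σ 0)| / 2 := by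
      field_simp
    rw [heq] at this
    linarith

end Summit.AtomisticToContinuum.FouriersLaw.Theorems.LocalOhmBirth

end
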